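import Literature.AlgebraicGeometry.Morphisms.CechH1Refinement
import HarnessLib

/-!
# The image of the refinement map `Ȟ¹(𝒰, 𝒪_X) → Ȟ¹(𝒱, 𝒪_X)`: Leray's acyclicity argument in degree one

Let `f : X → Spec A` be a scheme over a ring `A`, `𝒰 = (U_i)_i` and `𝒱 = (V_j)_j` families of opens
of `X` with a map of coverings `τ : 𝒱 → 𝒰` (`V_j ⊆ U_{τ j}`) such that `𝒱` covers every `U_i`
(`Morphisms/CechH1Refinement`). This file proves the degree-one case of Leray's theorem in Čech
form (Görtz–Wedhorn II, Cor. 21.82, whose hypothesis is the vanishing of the cohomology of `𝓕` on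
the members of `𝒰`; J.-P. Serre, FAC, n° 29; The Stacks Project, Tag 03F7):

* `exists_cechRefineH1_eq_mk` — if a Čech `1`-cocycle `z` of `𝒪_X` on `𝒱` becomes a coboundary
  on each `U_i`, i.e. on each family `𝒱|_{U_i} = (U_i ∩ V_j)_j`, then its class lies in the image
  of `Ȟ¹(𝒰, 𝒪_X) → Ȟ¹(𝒱, 𝒪_X)`.

Proof (the standard one): write `z |_{U_i} = d⁰ hⁱ`; the differences `hⁱ_j - h^{i'}_j` on
`U_i ∩ U_{i'} ∩ V_j` are independent of `j` (both `hⁱ` and `h^{i'}` have coboundary `z`), hence glue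
(sheaf property of `𝒪_X`) to `g_{ii'} ∈ Γ(U_i ∩ U_{i'})`; `g` is a cocycle (checked locally on the
`V_j`, where it telescopes), and `z - ρ_τ g = d⁰ e` with `e_j = h^{τ j}_j |_{V_j}`. Together with the
injectivity of refinement (`cechRefineH1_injective`) and the vanishing of `Ȟ¹` of `𝒪` on affine
opens this gives the independence of `Ȟ¹(𝒰, 𝒪_X)` from the affine covering `𝒰` in the form needed
for `Motives/KunnethH1Slices`. Mathlib searched (pin): no Čech cohomology of schemes, no Leray
theorem for coverings (`CategoryTheory/Sites/SheafCohomology` is derived-functor only).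

## References

* U. Görtz, T. Wedhorn, *Algebraic Geometry II: Cohomology of Schemes*, Springer Spektrum (2023),
  doi:10.1007/978-3-658-43031-3: Cor. 21.82 (Leray), p. 265; (21.16), p. 262 (read via the held
  copy). [GortzWedhorn2023]
* The Stacks Project, Tag 03F7 (Čech cohomology and refinements: acyclic coverings), Tag 09UY.
  [StacksProject]
-/

noncomputable section

open CategoryTheory AlgebraicGeometry Limits TopologicalSpace Opposite

universe u v w

namespace Literature.AlgebraicGeometry.Morphisms

variable {A : Type u} [CommRing A] {X : Scheme.{u}} (f : X ⟶ Spec (.of A))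
variable {ι : Type v} {ι' : Type w} (U : ι → X.Opens) (V : ι' → X.Opens) (τ : ι' → ι)
  (hτ : ∀ j, V j ≤ U (τ j))

/-- **Leray's acyclicity argument in degree one (Čech form).** Let `τ : 𝒱 → 𝒰` be a map of
families of opens with `𝒱` covering every `U_i`, and let `z` be a Čech `1`-cocycle of `𝒪_X` on `𝒱`
whose restriction to each family `(U_i ∩ V_j)_j` is a coboundary. Then `[z] ∈ Ȟ¹(𝒱, 𝒪_X)` is the
refinement of a class in `Ȟ¹(𝒰, 𝒪_X)` (Görtz–Wedhorn II, Cor. 21.82 for `n = 1`, with the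
acyclicity hypothesis only for the given cocycle). [cite: GortzWedhorn2023, Cor. 21.82 (p. 265)] -/
theorem exists_cechRefineH1_eq_mk (hU : ∀ i, U i ≤ ⨆ j, V j) (z : cechZ1 f V)
    (hloc : ∀ i, cechRefineC1 f V (fun j => U i ⊓ V j) id (fun _ => inf_le_right)
      (z : CechC1 f V) ∈ cechB1 f (fun j => U i ⊓ V j)) :
    ∃ y : CechH1 f U, cechRefineH1 f U V τ hτ y = CechH1.mk f V z := by
  choose h hh using fun i => (mem_cechB1_iff f _ _).mp (hloc i)
  -- `hh' i j j'`: `hⁱ_{j'} - hⁱ_j = z_{jj'}` on `(U_i ∩ V_j) ∩ (U_i ∩ V_{j'})`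
  have hh' : ∀ i j j',
      Sections.res f (inf_le_right : (U i ⊓ V j) ⊓ (U i ⊓ V j') ≤ _) (h i j') -
        Sections.res f (inf_le_left : (U i ⊓ V j) ⊓ (U i ⊓ V j') ≤ _) (h i j) =
      Sections.res f (inf_le_inf inf_le_right inf_le_right) ((z : CechC1 f V) j j') := by
    intro i j j'
    have e := congrFun (congrFun (hh i) j) j'
    rw [cechD0_apply, cechRefineC1_apply] at e
    exact e
  -- the differences `t^{ii'}_j = hⁱ_j - h^{i'}_j` on `U_i ∩ U_{i'} ∩ V_j`
  set t : ∀ i i' j, Sections f ((U i ⊓ U i') ⊓ V j) := fun i i' j =>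
    Sections.res f (le_inf (inf_le_left.trans inf_le_left) inf_le_right : _ ≤ U i ⊓ V j) (h i j) -
      Sections.res f (le_inf (inf_le_left.trans inf_le_right) inf_le_right : _ ≤ U i' ⊓ V j)
        (h i' j) with ht
  have hcovU : ∀ i i', U i ⊓ U i' ≤ ⨆ j, (U i ⊓ U i') ⊓ V j := fun i i' => by
    rw [← inf_iSup_eq]; exact le_inf le_rfl (inf_le_left.trans (hU i))
  -- they are independent of `j` on overlaps
  have hglue : ∀ i i' j j',
      Sections.res f (inf_le_left : ((U i ⊓ U i') ⊓ V j) ⊓ ((U i ⊓ U i') ⊓ V j') ≤ _) (t i i' j) =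
      Sections.res f (inf_le_right : ((U i ⊓ U i') ⊓ V j) ⊓ ((U i ⊓ U i') ⊓ V j') ≤ _)
        (t i i' j') := by
    intro i i' j j'
    simp only [ht, map_sub, Sections.res_res]
    have hWi : ((U i ⊓ U i') ⊓ V j) ⊓ ((U i ⊓ U i') ⊓ V j') ≤ U i :=
      inf_le_left.trans (inf_le_left.trans inf_le_left)
    have hWi' : ((U i ⊓ U i') ⊓ V j) ⊓ ((U i ⊓ U i') ⊓ V j') ≤ U i' :=
      inf_le_left.trans (inf_le_left.trans inf_le_right)
    have hWj : ((U i ⊓ U i') ⊓ V j) ⊓ ((U i ⊓ U i') ⊓ V j') ≤ V j := inf_le_left.trans inf_le_right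
    have hWj' : ((U i ⊓ U i') ⊓ V j) ⊓ ((U i ⊓ U i') ⊓ V j') ≤ V j' :=
      inf_le_right.trans inf_le_right
    have H1 := congrArg (Sections.res f
      (le_inf (le_inf hWi hWj) (le_inf hWi hWj') : _ ≤ (U i ⊓ V j) ⊓ (U i ⊓ V j'))) (hh' i j j')
    have H2 := congrArg (Sections.res f
      (le_inf (le_inf hWi' hWj) (le_inf hWi' hWj') : _ ≤ (U i' ⊓ V j) ⊓ (U i' ⊓ V j')))
      (hh' i' j j')
    rw [map_sub, Sections.res_res, Sections.res_res, Sections.res_res] at H1 H2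
    linear_combination -H1 + H2
  -- glue to `g_{ii'} ∈ Γ(U_i ∩ U_{i'})`
  choose g hg using fun i i' => Sections.exists_res_eq f (fun j => (U i ⊓ U i') ⊓ V j)
    (fun j => inf_le_left) (hcovU i i') (t i i') (hglue i i')
  -- `g` is a cocycle: on `U_i ∩ U_{i'} ∩ U_{i''} ∩ V_j` the sum telescopes
  have gZ : (g : CechC1 f U) ∈ cechZ1 f U := by
    rw [mem_cechZ1_iff]
    funext i i' i''
    rw [cechD1_apply]
    change _ = (0 : Sections f _)
    apply Sections.eq_of_res_eq f (fun j => (U i ⊓ U i' ⊓ U i'') ⊓ V j) (fun j => inf_le_left)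
    · rw [← inf_iSup_eq]
      exact le_inf le_rfl ((inf_le_left.trans inf_le_left).trans (hU i))
    intro j
    have hWi : (U i ⊓ U i' ⊓ U i'') ⊓ V j ≤ U i := inf_le_left.trans (inf_le_left.trans inf_le_left)
    have hWi' : (U i ⊓ U i' ⊓ U i'') ⊓ V j ≤ U i' :=
      inf_le_left.trans (inf_le_left.trans inf_le_right)
    have hWi'' : (U i ⊓ U i' ⊓ U i'') ⊓ V j ≤ U i'' := inf_le_left.trans inf_le_right
    have hWj : (U i ⊓ U i' ⊓ U i'') ⊓ V j ≤ V j := inf_le_right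
    have H1 := congrArg (Sections.res f
      (le_inf (le_inf hWi' hWi'') hWj : _ ≤ (U i' ⊓ U i'') ⊓ V j)) (hg i' i'' j)
    have H2 := congrArg (Sections.res f
      (le_inf (le_inf hWi hWi'') hWj : _ ≤ (U i ⊓ U i'') ⊓ V j)) (hg i i'' j)
    have H3 := congrArg (Sections.res f
      (le_inf (le_inf hWi hWi') hWj : _ ≤ (U i ⊓ U i') ⊓ V j)) (hg i i' j)
    simp only [ht, map_sub, Sections.res_res] at H1 H2 H3
    rw [map_zero, map_add, map_sub, Sections.res_res, Sections.res_res, Sections.res_res]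
    linear_combination H1 - H2 + H3
  -- `z - ρ g = d⁰ e` with `e_j = h^{τ j}_j |_{V_j}`
  set e : CechC0 f V := fun j =>
    Sections.res f (le_inf (hτ j) le_rfl : V j ≤ U (τ j) ⊓ V j) (h (τ j) j) with he
  have key : cechRefineC1 f U V τ hτ g - (z : CechC1 f V) ∈ cechB1 f V := by
    refine (mem_cechB1_iff f V _).mpr ⟨-e, ?_⟩
    funext j j'
    rw [map_neg, Pi.neg_apply, Pi.neg_apply, Pi.sub_apply, Pi.sub_apply, cechD0_apply,
      cechRefineC1_apply]
    simp only [he, Sections.res_res]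
    have hWj : V j ⊓ V j' ≤ V j := inf_le_left
    have hWj' : V j ⊓ V j' ≤ V j' := inf_le_right
    have hWi : V j ⊓ V j' ≤ U (τ j) := hWj.trans (hτ j)
    have hWi' : V j ⊓ V j' ≤ U (τ j') := hWj'.trans (hτ j')
    have G := congrArg (Sections.res f
      (le_inf (le_inf hWi hWi') hWj' : _ ≤ (U (τ j) ⊓ U (τ j')) ⊓ V j')) (hg (τ j) (τ j') j')
    have Z := congrArg (Sections.res f
      (le_inf (le_inf hWi hWj) (le_inf hWi hWj') : _ ≤ (U (τ j) ⊓ V j) ⊓ (U (τ j) ⊓ V j')))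
      (hh' (τ j) j j')
    simp only [ht, map_sub, Sections.res_res] at G Z
    rw [Sections.res_self] at Z
    linear_combination -G - Z
  refine ⟨CechH1.mk f U ⟨g, gZ⟩, ?_⟩
  rw [cechRefineH1_mk, CechH1.mk_eq_mk_iff, cechRefineZ1_coe]
  exact key

/-- The same with the local triviality hypothesis in class form: if `𝒱` covers every `U_i` and
`Ȟ¹((U_i ∩ V_j)_j, 𝒪_X) = 0` for all `i`, the refinement map `Ȟ¹(𝒰, 𝒪_X) → Ȟ¹(𝒱, 𝒪_X)` is
surjective (hence bijective, `cechRefineH1_injective`). [cite: GortzWedhorn2023, Cor. 21.82 (p. 265)] -/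
theorem cechRefineH1_surjective (hU : ∀ i, U i ≤ ⨆ j, V j)
    (hloc : ∀ i, cechZ1 f (fun j => U i ⊓ V j) ≤ cechB1 f (fun j => U i ⊓ V j)) :
    Function.Surjective (cechRefineH1 f U V τ hτ) := by
  intro x
  obtain ⟨z, rfl⟩ := CechH1.mk_surjective f V x
  exact exists_cechRefineH1_eq_mk f U V τ hτ hU z fun i =>
    hloc i (refineC1_mem_cechZ1 f V _ id _ z.2)

end Literature.AlgebraicGeometry.Morphisms

end
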